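import Summits.CriticalPhenomena.CardyFormulaZ2.Theses.CardyRotToConf
import Summits.CriticalPhenomena.CardyFormulaZ2.Theorems.CardyRotToConfR2SymmetryUpgrade.Negative.CurveTransport
import Literature.Probability.RandomPlanarGeometry.SLEExistenceConverse
import Literature.Probability.RandomPlanarGeometry.ChordalRestrictionMarkov
import Literature.Probability.RandomPlanarGeometry.LocalMartingaleProofs

/-!
# `CardyRotToConfR2SymmetryUpgrade` (stmt-CriticalPhenomena-0698): load-bearing clauses of
# `IsChordal`, and what `IsLocal` / `IsDomainMarkov` alone force

By-product of the cdisprove unit (standing adversary) for the provers of the crux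
`∀ P, IsLocalMarkovChordalFamily P → (non-tracing) → ∀ D, IsSLELaw 6 D (P D)`.

* `not_isSLELaw_dirac_of_target_ne`, `not_isSLELaw_zero` — unconditional non-SLE certificates
  (the pre-Wiener measure is a probability measure, `isProjectiveLimit_preWienerMeasure_holds`);
* `crux_false_without_isChordal`, `crux_false_without_targetClause` — dropping `IsChordal`, or
  only its target clause `γ.target = b`, from the hypotheses makes the crux FALSE: the tree's
  `tipFamily` ("stay at `a`") passes similarity covariance, domain Markov, both locality forms
  AND the non-tracing clause (`nonTracing_tipFamily`);
* `crux_false_without_probability` — dropping only `IsProbabilityMeasure (P D)` makes it false: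
  the zero family passes everything else;
* `eq_of_isLocal_of_carrier_eq`, `eq_of_isDomainMarkov_of_carrier_eq` — restriction locality
  ALONE, and the domain Markov property ALONE, force `P D` to depend on `D` only through
  `(carrier, a, b)`: the boundary parametrisation of a `MarkedDomain` (in particular its
  orientation) is invisible to an admissible family, so chirality can only come from the
  orientation of `ℂ`;
* `not_isLocal_arcFamily`, `not_isDomainMarkov_arcFamily` — the claims "neither local nor Markov"
  of the docstring of `ChordalFamily.arcFamily`, PROVED, by the orientation clash between the
  unit disc and its conjugate `unitDisc.map conj` (same carrier and marks, clockwise boundary);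
  `isTargetIndependent_arcFamily` — the boundary tracer nevertheless passes splitting locality.
-/

noncomputable section

open Set MeasureTheory Topology Filter
open scoped unitInterval ENNReal NNReal ComplexConjugate

namespace Summit.CriticalPhenomena.CardyFormulaZ2.Theorems.CardyRotToConfR2SymmetryUpgrade.Negative

open Literature.Probability.RandomPlanarGeometry
open Literature.Probability.RandomPlanarGeometry.ChordalFamily
open Summit.CriticalPhenomena.CardyFormulaZ2.Theses.CardyRotToConf
open Complex (conjLIE conj_conj)

/-! ### Unconditional non-SLE certificates -/

/-- A Dirac mass at a curve class whose endpoint is not `b` is not an SLE law of `(D; a, b)`: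
SLE curves end at `b` almost surely and the pre-Wiener measure is a probability measure
(`isProjectiveLimit_preWienerMeasure_holds`). [folklore] -/
theorem not_isSLELaw_dirac_of_target_ne {κ : ℝ≥0} {D : DobrushinDomain} {x : CurveClass ℂ}
    (hx : x.target ≠ D.pt 1) : ¬ IsSLELaw κ D (Measure.dirac x) := by
  rintro ⟨Γ, ⟨hΓm, φ, -, hae⟩, hlaw⟩
  haveI : Fact Literature.Probability.Process.isProjectiveLimit_preWienerMeasure :=
    ⟨isProjectiveLimit_preWienerMeasure_holds⟩
  have h1 : ∀ᵐ ω ∂Literature.Probability.Process.preWienerMeasure, Γ ω = x := by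
    have h0 : (Literature.Probability.Process.preWienerMeasure.map Γ) {x}ᶜ = 0 := by
      rw [← hlaw, Measure.dirac_apply' _ (measurableSet_singleton x).compl]
      simp
    rw [Measure.map_apply_of_aemeasurable hΓm (measurableSet_singleton x).compl] at h0
    rw [ae_iff]
    simpa [Set.preimage, Set.compl_def] using h0
  obtain ⟨ω, hω, -, c, hc, hcomp⟩ := (h1.and hae).exists
  apply hx
  rw [← hω, hc, CurveClass.target_mk, Curve.target_def]
  exact hcomp.2

/-- The zero measure is not an SLE law (an SLE law has total mass one). [folklore] -/
theorem not_isSLELaw_zero {κ : ℝ≥0} {D : DobrushinDomain} :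
    ¬ IsSLELaw κ D (0 : Measure (CurveClass ℂ)) := by
  rintro ⟨Γ, hΓ, hlaw⟩
  haveI : Fact Literature.Probability.Process.isProjectiveLimit_preWienerMeasure :=
    ⟨isProjectiveLimit_preWienerMeasure_holds⟩
  have h := congrArg (fun μ : Measure (CurveClass ℂ) => μ Set.univ) hlaw
  simp only [Measure.coe_zero, Pi.zero_apply] at h
  rw [Measure.map_apply_of_aemeasurable hΓ.aemeasurable MeasurableSet.univ, Set.preimage_univ,
    measure_univ] at h
  exact zero_ne_one h

/-- `tipFamily` is not an SLE law: the constant curve at `a` ends at `a ≠ b`. [folklore] -/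
theorem not_isSLELaw_tipFamily (κ : ℝ≥0) (D : DobrushinDomain) :
    ¬ IsSLELaw κ D (tipFamily D) :=
  not_isSLELaw_dirac_of_target_ne (by
    simp only [CurveClass.target_mk, Curve.target_def, Curve.const_apply]
    exact fun h => absurd (D.pt_injective h) (by decide))

/-- `tipFamily` does not trace the boundary (its only representative is the constant curve):
it satisfies the non-tracing clause of the crux. [folklore] -/
theorem nonTracing_tipFamily (D : DobrushinDomain) :
    ∀ᵐ γ ∂(tipFamily D), ∀ c : Curve ℂ, CurveClass.mk c = γ →
      ∀ s t : unitInterval, s < t → c '' Set.Icc s t ⊆ frontier D.carrier →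
        (c '' Set.Icc s t).Subsingleton := by
  rw [tipFamily, ae_dirac_eq, eventually_pure]
  intro c hc s t _ _
  have hdist : dist c (Curve.const (D.pt 0)) = 0 := CurveClass.mk_eq_mk_iff_dist_eq_zero.1 hc
  rw [Curve.eq_const_of_dist_eq_zero hdist]
  rintro _ ⟨u, -, rfl⟩ _ ⟨v, -, rfl⟩
  rfl

/-! ### `IsChordal` is load-bearing, clause by clause -/

/-- **`IsChordal` is load-bearing**: with `IsChordal` dropped from the bundle the crux is FALSE —
the tree's `tipFamily` ("stay at `a`") satisfies every remaining hypothesis INCLUDING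
non-tracing. Any proof of the crux must use chordality. [folklore] -/
theorem crux_false_without_isChordal :
    ¬ ∀ P : ChordalFamily, P.IsSimilarityCovariant → P.IsDomainMarkov → P.IsLocal →
      P.IsTargetIndependent →
      (∀ D : DobrushinDomain, ∀ᵐ γ ∂(P D), ∀ c : Curve ℂ, CurveClass.mk c = γ →
        ∀ s t : unitInterval, s < t → c '' Set.Icc s t ⊆ frontier D.carrier →
          (c '' Set.Icc s t).Subsingleton) →
      ∀ D : DobrushinDomain, IsSLELaw 6 D (P D) := fun h =>
  not_isSLELaw_tipFamily 6 DobrushinDomain.unitDisc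
    (h tipFamily isSimilarityCovariant_tipFamily isDomainMarkov_tipFamily isLocal_tipFamily
      isTargetIndependent_tipFamily nonTracing_tipFamily _)

/-- **The target clause of `IsChordal` is load-bearing on its own** (probability, source and
range clauses kept): `tipFamily` again. [folklore] -/
theorem crux_false_without_targetClause :
    ¬ ∀ P : ChordalFamily,
      (∀ D : DobrushinDomain, IsProbabilityMeasure (P D) ∧
        ∀ᵐ γ ∂(P D), γ.source = D.pt 0 ∧ γ.range ⊆ closure D.carrier) →
      P.IsSimilarityCovariant → P.IsDomainMarkov → P.IsLocal → P.IsTargetIndependent →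
      (∀ D : DobrushinDomain, ∀ᵐ γ ∂(P D), ∀ c : Curve ℂ, CurveClass.mk c = γ →
        ∀ s t : unitInterval, s < t → c '' Set.Icc s t ⊆ frontier D.carrier →
          (c '' Set.Icc s t).Subsingleton) →
      ∀ D : DobrushinDomain, IsSLELaw 6 D (P D) := fun h =>
  not_isSLELaw_tipFamily 6 DobrushinDomain.unitDisc
    (h tipFamily (fun D => ⟨Measure.dirac.isProbabilityMeasure, by
        rw [tipFamily, ae_dirac_eq, eventually_pure]
        refine ⟨rfl, ?_⟩
        rw [CurveClass.range_mk, Curve.range_const, Set.singleton_subset_iff]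
        exact frontier_subset_closure (D.pt_mem_frontier 0)⟩)
      isSimilarityCovariant_tipFamily isDomainMarkov_tipFamily isLocal_tipFamily
      isTargetIndependent_tipFamily nonTracing_tipFamily _)

/-- **The probability clause is load-bearing**: with only `IsProbabilityMeasure (P D)` dropped
(the a.s. source / target / range clauses kept) the crux is FALSE — the ZERO family `P D = 0`
satisfies every other hypothesis vacuously (they are a.e. statements, measure identities or
`0 = ∫ … ∂0`). [folklore] -/
theorem crux_false_without_probability :
    ¬ ∀ P : ChordalFamily,
      (∀ D : DobrushinDomain, ∀ᵐ γ ∂(P D),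
        γ.source = D.pt 0 ∧ γ.target = D.pt 1 ∧ γ.range ⊆ closure D.carrier) →
      P.IsSimilarityCovariant → P.IsDomainMarkov → P.IsLocal → P.IsTargetIndependent →
      (∀ D : DobrushinDomain, ∀ᵐ γ ∂(P D), ∀ c : Curve ℂ, CurveClass.mk c = γ →
        ∀ s t : unitInterval, s < t → c '' Set.Icc s t ⊆ frontier D.carrier →
          (c '' Set.Icc s t).Subsingleton) →
      ∀ D : DobrushinDomain, IsSLELaw 6 D (P D) := fun h => by
  refine not_isSLELaw_zero (D := DobrushinDomain.unitDisc)
    (h (fun _ => 0) (fun D => ae_zero.symm ▸ eventually_bot) ?_ ?_ ?_ ?_ ?_ _)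
  · intro D c hc w
    simp
  · refine ⟨fun _ _ => 0, fun _ => rfl, ?_, fun _ _ _ _ _ _ _ => rfl⟩
    intro D F _ S T _ _
    simp
  · intro D D' _ _ _ T _
    rfl
  · intro D T _
    rfl
  · intro D
    exact ae_zero.symm ▸ eventually_bot

/-! ### `IsLocal` and `IsDomainMarkov` see only `(carrier, a, b)` -/

/-- Stopping at the empty set does nothing (the hitting parameter is `1`). [folklore] -/
theorem stopAt_empty (c : CurveClass ℂ) : CurveClass.stopAt (∅ : Set ℂ) c = c := by
  obtain ⟨γ, rfl⟩ := CurveClass.surjective_mk c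
  rw [CurveClass.stopAt_mk_holds ∅ isClosed_empty,
    Curve.stopAt_eq_self_of_hitParam_eq_one
      (Curve.hitParam_eq_one_of_forall_notMem fun t => Set.notMem_empty _)]

/-- **Restriction locality alone makes the boundary parametrisation invisible**: two Dobrushin
domains with the same carrier and the same two marked points get the same law (take `D' = D` as
sets: the stopping set `closure (D ∖ D')` is empty). [folklore] -/
theorem eq_of_isLocal_of_carrier_eq {P : ChordalFamily} (h : P.IsLocal)
    {D₁ D₂ : DobrushinDomain} (hc : D₁.carrier = D₂.carrier) (h0 : D₁.pt 0 = D₂.pt 0)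
    (h1 : D₁.pt 1 = D₂.pt 1) : P D₁ = P D₂ := by
  ext T hT
  have key := h D₂ D₁ hc.le h0 h1 T hT
  have hF : closure (D₂.carrier \ D₁.carrier) = ∅ := by rw [hc]; simp
  have hpre : CurveClass.stopAt (closure (D₂.carrier \ D₁.carrier)) ⁻¹' T = T := by
    ext c; simp [hF, stopAt_empty]
  simpa [hpre] using key

/-- **The domain Markov property alone makes the boundary parametrisation invisible**: with
nothing explored the remaining domain is the carrier (`remainingDomain_mk_const`), so `initial`
and `domain` give `P D₁ = Q D₁ (const a) = Q D₂ (const a) = P D₂`. [folklore] -/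
theorem eq_of_isDomainMarkov_of_carrier_eq {P : ChordalFamily} (h : P.IsDomainMarkov)
    {D₁ D₂ : DobrushinDomain} (hc : D₁.carrier = D₂.carrier) (h0 : D₁.pt 0 = D₂.pt 0)
    (h1 : D₁.pt 1 = D₂.pt 1) : P D₁ = P D₂ := by
  obtain ⟨Q, hQ⟩ := h
  rw [← hQ.initial D₁, ← hQ.initial D₂, h0]
  refine hQ.domain D₁ D₂ _ _ ?_ rfl h1
  rw [← h0, remainingDomain_mk_const, h0, remainingDomain_mk_const, hc]

/-! ### The unit disc against its conjugate: `arcFamily` is neither local nor Markov -/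

/-- The conjugate of the unit disc has the same carrier. [folklore] -/
theorem carrier_unitDisc_map_conj :
    (DobrushinDomain.unitDisc.map conjLIE.toHomeomorph).carrier =
      DobrushinDomain.unitDisc.carrier := by
  rw [MarkedDomain.carrier_map, ← conjH_preimage]
  ext z
  simp [DobrushinDomain.unitDisc]

/-- The conjugate of the unit disc has the same first marked point `a = 1`. [folklore] -/
theorem pt_zero_unitDisc_map_conj :
    (DobrushinDomain.unitDisc.map conjLIE.toHomeomorph).pt 0 = DobrushinDomain.unitDisc.pt 0 := by
  have h : DobrushinDomain.unitDisc.pt 0 = 1 := by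
    change circleMap 0 1 (2 * Real.pi * ((![0, 1 / 2] : Fin 2 → ℝ) 0)) = 1
    simp [circleMap]
  rw [MarkedDomain.pt_map, h, conjLIE_toHomeomorph_apply, map_one]

/-- The conjugate of the unit disc has the same second marked point `b = -1`. [folklore] -/
theorem pt_one_unitDisc_map_conj :
    (DobrushinDomain.unitDisc.map conjLIE.toHomeomorph).pt 1 = DobrushinDomain.unitDisc.pt 1 := by
  have h : DobrushinDomain.unitDisc.pt 1 = -1 := by
    change circleMap 0 1 (2 * Real.pi * ((![0, 1 / 2] : Fin 2 → ℝ) 1)) = -1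
    have e : 2 * Real.pi * ((![0, 1 / 2] : Fin 2 → ℝ) 1) = Real.pi := by
      simp only [Matrix.cons_val_one, Matrix.cons_val_fin_one]
      ring
    rw [e]
    simp [circleMap, Complex.exp_pi_mul_I]
  rw [MarkedDomain.pt_map, h, conjLIE_toHomeomorph_apply, map_neg, map_one]

/-- `e^{iπ/2} = i`. [folklore] -/
theorem circleMap_pi_div_two : circleMap 0 1 (Real.pi / 2) = Complex.I := by
  rw [circleMap, zero_add, Complex.ofReal_one, one_mul, Complex.exp_mul_I, ← Complex.ofReal_cos,
    ← Complex.ofReal_sin, Real.cos_pi_div_two, Real.sin_pi_div_two]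
  simp

/-- The point `i` lies on the arc `(ab)` (upper half circle) of the unit disc … [folklore] -/
theorem I_mem_range_arcCurve_unitDisc :
    Complex.I ∈ (DobrushinDomain.unitDisc.arcCurve 0).range := by
  refine ⟨⟨1 / 2, by norm_num, by norm_num⟩, ?_⟩
  simp only [MarkedDomain.arcCurve_apply]
  change circleMap 0 1 (2 * Real.pi * ((![0, 1 / 2] : Fin 2 → ℝ) 0 +
    (DobrushinDomain.unitDisc.nextMark 0 - (![0, 1 / 2] : Fin 2 → ℝ) 0) * (1 / 2 : ℝ))) =
      Complex.I
  have hn : DobrushinDomain.unitDisc.nextMark 0 = 1 / 2 := by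
    simp [MarkedDomain.nextMark, DobrushinDomain.unitDisc]
  rw [hn]
  simp only [Matrix.cons_val_zero]
  have e : 2 * Real.pi * (0 + (1 / 2 - 0) * (1 / 2 : ℝ)) = Real.pi / 2 := by ring
  rw [e, circleMap_pi_div_two]

/-- … while `-i` does not. [folklore] -/
theorem neg_I_notMem_range_arcCurve_unitDisc :
    -Complex.I ∉ (DobrushinDomain.unitDisc.arcCurve 0).range := by
  rintro ⟨s, hs⟩
  simp only [MarkedDomain.arcCurve_apply] at hs
  change circleMap 0 1 (2 * Real.pi * ((![0, 1 / 2] : Fin 2 → ℝ) 0 +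
    (DobrushinDomain.unitDisc.nextMark 0 - (![0, 1 / 2] : Fin 2 → ℝ) 0) * (s : ℝ))) =
      -Complex.I at hs
  have hn : DobrushinDomain.unitDisc.nextMark 0 = 1 / 2 := by
    simp [MarkedDomain.nextMark, DobrushinDomain.unitDisc]
  rw [hn] at hs
  simp only [Matrix.cons_val_zero, zero_add, sub_zero] at hs
  have e : 2 * Real.pi * (1 / 2 * (s : ℝ)) = Real.pi * s := by ring
  rw [e] at hs
  have hs' : Complex.exp (((Real.pi * (s : ℝ) : ℝ) : ℂ) * Complex.I) = -Complex.I := by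
    have e' : circleMap 0 1 (Real.pi * s) =
        Complex.exp (((Real.pi * (s : ℝ) : ℝ) : ℂ) * Complex.I) := by
      simp [circleMap]
    rw [← e']
    exact hs
  have him : Real.sin (Real.pi * s) = -1 := by
    have := congrArg Complex.im hs'
    rwa [Complex.exp_ofReal_mul_I_im, Complex.neg_im, Complex.I_im] at this
  have h0 : 0 ≤ Real.sin (Real.pi * s) :=
    Real.sin_nonneg_of_nonneg_of_le_pi (mul_nonneg Real.pi_pos.le s.2.1)
      (by nlinarith [Real.pi_pos, s.2.2])
  linarith

/-- Hence `-i` lies on the arc `(ab)` (lower half circle) of the CONJUGATE disc. [folklore] -/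
theorem neg_I_mem_range_arcCurve_unitDisc_map_conj :
    -Complex.I ∈ ((DobrushinDomain.unitDisc.map conjLIE.toHomeomorph).arcCurve 0).range := by
  rw [MarkedDomain.arcCurve_map, Curve.range_map]
  exact ⟨Complex.I, I_mem_range_arcCurve_unitDisc, by simp [conjLIE_toHomeomorph_apply]⟩

/-- The boundary tracer distinguishes the unit disc from its conjugate (same carrier and marks).
[folklore] -/
theorem arcFamily_unitDisc_map_conj_ne :
    arcFamily (DobrushinDomain.unitDisc.map conjLIE.toHomeomorph) ≠
      arcFamily DobrushinDomain.unitDisc := by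
  intro h
  have hx : CurveClass.mk ((DobrushinDomain.unitDisc.map conjLIE.toHomeomorph).arcCurve 0) =
      CurveClass.mk (DobrushinDomain.unitDisc.arcCurve 0) := by
    have h1 : arcFamily (DobrushinDomain.unitDisc.map conjLIE.toHomeomorph)
        {CurveClass.mk (DobrushinDomain.unitDisc.arcCurve 0)} = 1 := by
      rw [h]
      exact Measure.dirac_apply_of_mem (Set.mem_singleton _)
    rw [arcFamily, Measure.dirac_apply' _ (measurableSet_singleton _)] at h1
    by_contra hne
    rw [Set.indicator_of_notMem (by simpa using hne)] at h1
    exact zero_ne_one h1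
  have hr := congrArg CurveClass.range hx
  simp only [CurveClass.range_mk] at hr
  exact neg_I_notMem_range_arcCurve_unitDisc (hr ▸ neg_I_mem_range_arcCurve_unitDisc_map_conj)

/-- **`arcFamily` is not local** (the docstring claim of `ChordalFamily.arcFamily`, proved):
locality would identify its values on the unit disc and on its conjugate. [folklore] -/
theorem not_isLocal_arcFamily : ¬ arcFamily.IsLocal := fun h =>
  arcFamily_unitDisc_map_conj_ne
    (eq_of_isLocal_of_carrier_eq h carrier_unitDisc_map_conj pt_zero_unitDisc_map_conj
      pt_one_unitDisc_map_conj)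

/-- **`arcFamily` is not domain Markov** (the docstring claim of `ChordalFamily.arcFamily`,
proved): `initial` + `domain` identify the unit disc with its conjugate — an ORIENTATION CLASH.
[folklore] -/
theorem not_isDomainMarkov_arcFamily : ¬ arcFamily.IsDomainMarkov := fun h =>
  arcFamily_unitDisc_map_conj_ne
    (eq_of_isDomainMarkov_of_carrier_eq h carrier_unitDisc_map_conj pt_zero_unitDisc_map_conj
      pt_one_unitDisc_map_conj)

end Summit.CriticalPhenomena.CardyFormulaZ2.Theorems.CardyRotToConfR2SymmetryUpgrade.Negative
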